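/-
Origin: expansion seat `prover-pub-hodgecm-mc-binder-1-g16-0`, handover #R114 2026-08-20T20:52:25Z md5 e9d6fc47fc0e (90 l.; NEW additive MODEL leaf; imports HodgeCM.Model.TowerLevel (#R108, RUN 62) only; drop-alone; NAMES for audit: HodgeCM.Model.TowerLevel.mem_towerLevel_of_translate_of_invariant · HodgeCM.Model.TowerLevel.apply_eq_trPull_self · HodgeCM.Model.TowerLevel.apply_eq_trPull_mul_of_mem; all decls: HodgeCM.Model.TowerLevel.transCond_self · HodgeCM.Model.TowerLevel.transCond_mul_of_mem · HodgeCM.Model.TowerLevel.mem_towerLevel_of_translate_of_invariant · HodgeCM.Model.TowerLevel.mem_towerLevel_of_translate_of_invariant' · HodgeCM.Model.TowerLevel.apply_eq_trPull_self · HodgeCM.Model.TowerLevel.apply_eq_trPull_mul_of_mem) (`HOME/mc/pub-hodgecm-mc-binder-1-g16/stage63/HodgeCM/Model/TowerLevelCriterion.lean`, md5 e9d6fc47fc0e, 90 lines);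
landed by the gen-26 packager (p-g26) in gate run 63 as `HodgeCM/Model/TowerLevelCriterion.lean` (verbatim).
-/
/-
Copyright (c) 2026 the pub-hodgecm formalisation cell (harness21).  New file, not vendored.
Origin: session prover-pub-hodgecm-mc-binder-1-g16-0 (unit pub-hodgecm-mc-binder-1-g16, BINDER PROVER gen 16 of lineage mc-binder-1;
content lane (J-Liu-Θ), (J3) HECKE-TOWER — membership criterion for the level-`K` carrier, for the (J4) seam
`Model/AdelicThetaTowerClass` of sinst-1), 2026-08-20.
-/
import Summits.HodgeConjecture.HodgeCM.Model.TowerLevel_2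

/-!
# Membership in `towerLevel`: rational translates + right-`K`-invariance suffice

`c ∈ towerLevel … Γ hΓ` is by definition the equivariance `c h = t_γ^* (c h')` for every `γ ∈ U(V)(L₀)`, `h`, and `h' ∈ (γ)_f h K`
(`Rel Γ γ h h'`).  It is enough to check the two generating cases

* (i)  `c h = t_γ^* (c ((γ)_f h))` for all rational `γ` and all `h` (`Rel.self`), and
* (ii) `c h = t_1^* (c (h k))` for all `h` and `k ∈ K` (`Rel.one_of_mem`),

since `t_γ^* ∘ t_1^* = t_γ^*` through any intermediate level (`trPull_trPull`).  This is the form in which the (J4) side proves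
membership of the family of component classes of an adèlic theta form: (i) is #R104 `pull_mem_thetaClasses_of_rightTranslateHom`-shaped,
(ii) is right-`K`-invariance of the form.
-/

noncomputable section

open NumberField
open Literature.AlgebraicGeometry.HodgeTheory
open Literature.NumberTheory.Automorphic
open Literature.NumberTheory.Automorphic.PicardCM
open Literature.NumberTheory.Transcendental (Arapura2012_Cor_15_4_6)

namespace HodgeCM.Model.TowerLevel

open HodgeCM.Model.LevelTranslate

variable (hHD : exists_isReal_hodgeModel) (hI : hodgePQ_independent_of_hodgeModel)
  (hU : BallQuotientUniformisedDatum) (h₃ : CMAbelianVarietyRealised) (hA : Arapura2012_Cor_15_4_6)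
variable {L : CMField} {ι₁ : L →+* ℂ} {V : HermSpace3 L ι₁} {Γ : Level V} (hΓ : Γ.BelowConjThree)

/-- The rational-translate condition (i) at `(γ, h)`, with its canonical `TransCond`. -/
theorem transCond_self (γ : ↥(Urat V)) (h : V.adelicFin) :
    TransCond (γ : GL (Fin 3) L) (Γ.conj h hΓ) (Γ.conj (ρ V γ * h) hΓ) :=
  transCond_of_rel hΓ (Rel.self γ h)

/-- The right-`K`-invariance condition (ii) at `(h, k)`, with its canonical `TransCond`. -/
theorem transCond_mul_of_mem (h : V.adelicFin) {k : V.adelicFin} (hk : k ∈ Γ.K) :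
    TransCond ((1 : ↥(Urat V)) : GL (Fin 3) L) (Γ.conj h hΓ) (Γ.conj (h * k) hΓ) :=
  transCond_of_rel hΓ (Rel.one_of_mem hk)

/-- **Membership criterion for `towerLevel`.**  A family `c` over the components belongs to `H_K` as soon as
(i) `c h = t_γ^* (c ((γ)_f h))` for all rational `γ` and all `h`, and (ii) `c h = t_1^* (c (h k))` for all `h` and `k ∈ K`. -/
theorem mem_towerLevel_of_translate_of_invariant (c : Π h : V.adelicFin, W hHD hI hU h₃ Γ hΓ h)
    (htr : ∀ (γ : ↥(Urat V)) (h : V.adelicFin),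
      c h = trPull hHD hI hU h₃ hA γ (Γ.conj h hΓ) (Γ.conj (ρ V γ * h) hΓ) (transCond_self hΓ γ h) 1 (c (ρ V γ * h)))
    (hinv : ∀ (h : V.adelicFin) {k : V.adelicFin} (hk : k ∈ Γ.K),
      c h = trPull hHD hI hU h₃ hA 1 (Γ.conj h hΓ) (Γ.conj (h * k) hΓ) (transCond_mul_of_mem hΓ h hk) 1 (c (h * k))) :
    c ∈ towerLevel hHD hI hU h₃ hA Γ hΓ := by
  refine (mem_towerLevel_iff hHD hI hU h₃ hA).mpr fun γ h h' r ↦ ?_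
  obtain ⟨k, hk, rfl⟩ := r
  have ht : TransCond (γ : GL (Fin 3) L) (Γ.conj h hΓ) (Γ.conj (ρ V γ * h * k) hΓ) :=
    transCond_of_rel hΓ ⟨k, hk, rfl⟩
  rw [htr γ h, hinv (ρ V γ * h) hk, trPull_trPull hHD hI hU h₃ hA (one_mul γ).symm _ _ ht]

/-- The criterion with arbitrary `TransCond` proofs in the hypotheses (useful when the caller's conditions come in another form). -/
theorem mem_towerLevel_of_translate_of_invariant' (c : Π h : V.adelicFin, W hHD hI hU h₃ Γ hΓ h)
    (htr : ∀ (γ : ↥(Urat V)) (h : V.adelicFin), ∃ ht : TransCond (γ : GL (Fin 3) L) (Γ.conj h hΓ) (Γ.conj (ρ V γ * h) hΓ),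
      c h = trPull hHD hI hU h₃ hA γ (Γ.conj h hΓ) (Γ.conj (ρ V γ * h) hΓ) ht 1 (c (ρ V γ * h)))
    (hinv : ∀ (h : V.adelicFin) {k : V.adelicFin}, k ∈ Γ.K →
      ∃ ht : TransCond ((1 : ↥(Urat V)) : GL (Fin 3) L) (Γ.conj h hΓ) (Γ.conj (h * k) hΓ),
        c h = trPull hHD hI hU h₃ hA 1 (Γ.conj h hΓ) (Γ.conj (h * k) hΓ) ht 1 (c (h * k))) :
    c ∈ towerLevel hHD hI hU h₃ hA Γ hΓ :=
  mem_towerLevel_of_translate_of_invariant hHD hI hU h₃ hA hΓ c (fun γ h ↦ (htr γ h).choose_spec)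
    (fun h _ hk ↦ (hinv h hk).choose_spec)

/-- Conversely, members satisfy (i) … -/
theorem apply_eq_trPull_self (c : towerLevel hHD hI hU h₃ hA Γ hΓ) (γ : ↥(Urat V)) (h : V.adelicFin) :
    (c : Π h, W hHD hI hU h₃ Γ hΓ h) h =
      trPull hHD hI hU h₃ hA γ (Γ.conj h hΓ) (Γ.conj (ρ V γ * h) hΓ) (transCond_self hΓ γ h) 1
        ((c : Π h, W hHD hI hU h₃ Γ hΓ h) (ρ V γ * h)) :=
  apply_eq_trPull hHD hI hU h₃ hA c (Rel.self γ h) _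

/-- … and (ii). -/
theorem apply_eq_trPull_mul_of_mem (c : towerLevel hHD hI hU h₃ hA Γ hΓ) (h : V.adelicFin) {k : V.adelicFin} (hk : k ∈ Γ.K) :
    (c : Π h, W hHD hI hU h₃ Γ hΓ h) h =
      trPull hHD hI hU h₃ hA 1 (Γ.conj h hΓ) (Γ.conj (h * k) hΓ) (transCond_mul_of_mem hΓ h hk) 1
        ((c : Π h, W hHD hI hU h₃ Γ hΓ h) (h * k)) :=
  apply_eq_of_mem hHD hI hU h₃ hA c h hk _

end HodgeCM.Model.TowerLevel

end
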